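import Summits.QuantumFields.YangMills.Theorems.UnitScaleTiltProp7FrameRem2RowZeroT3
import Summits.QuantumFields.YangMills.Theorems.UnitScaleTiltProp7CovIterLambdaHLambdaBridge
import Summits.QuantumFields.YangMills.Theorems.UnitScaleTiltProp7TwistedLevelMassOfRegPr
import HarnessLib

/-!
# `UnitScaleTiltProp7PertVarNormGradLevelZeroT3` — N4b OF THE «(n3)₂-sym» SUPPLIER LINE (px21 g7 LOCATE «H2-1ˢ» 3c6e40d5, re-cut 08:02:49Z): **THE LATTICE GRADIENT OF THE NORM FIELD `b ↦ ‖Y b‖`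
# IS BOUNDED BY THE COVARIANT GRADIENT OF `Y`, HENCE BY `CURL + DIV + curvature·mass` (the tree's Weitzenböck row), AT LEVEL 0, FOR `Y = pertVar W (e^{iX}W)` AND `Y = iX`, IN THE
# X-CURRENCY OF px16's `hN2s` B-SLOT** (`K_W(iX)` = the door's plaquette form, `DIV_W(iX)`, `((L^{K−n})²)⁻¹·Σ‖X b‖²`)
(route `UnitScaleTilt`, crux K1 «MinimiserStabilityRegPr» stmt-QuantumFields-19200; R0-RECURSION lane → REM2ˢ → «(n3)₂-sym» = H2-1ˢ; def-free, count-neutral).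
Cell `ym3-torus` (HUMAN RULING D-0037, YM ladder rung R3 — YM₃ on T³ is a rung, not d = 4, not infinite volume, not a mass gap, not Clay), width seat `ym3-torus-px13` (gen 6).

WHY.  The supplier's level-0 localisation (px18 ✓`sum_sq_le_localisedMass(_chain)`, N4) prices a corner-localised ℓ² mass of a REAL field `v` by its lattice gradient `Σ(v(x+e_ν) − v(x))²`; the field is
`v = ‖Y_0(·)‖`.  Norms are `Ad`-invariant, so `|‖Y(b+e_ν)‖ − ‖Y(b)‖| ≤ ‖W(x,ν)·Y(b+e_ν)·W(x,ν)⋆ − Y(b)‖` (§1), and the covariant gradient energy is the tree's Weitzenböck row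
✓`Prop7CovIterLambdaHLambdaBridge.sum_normSq_covGrad_le_curl_divB` (`≤ CURL_HS + DIV_HS + 2d·a·N·Σ‖Y‖²`, `a` the plaquette bound) (§2); the exchange to X-letters is ✓`Prop7PlaquetteCurlComparison.curlHS_le_plaqK`
∕ ✓`Prop7PertVarCurrencyExchange.curlHS_pertVar_le_plaqK` ∕ `divHS_pertVar_le` ∕ `sum_normSq_pertVar_le` (§3); at the member `a = e·((L^{K−n})²)⁻¹` is `RegPr`'s plaquette clause (✓`plaq_le_of_regPr`) (§4).
WHAT IS PROVED (sorry-free): §1 `norm_le_norm_conj_su` (`‖Y‖ ≤ ‖uYu⋆‖`, so `Ad` is an isometry with ✓`norm_conj_su_le`), `sq_norm_sub_norm_le_normSq_conj_sub`, `sum_sq_norm_sub_norm_le_covGrad`, `sum_sq_norm_sub_norm_dir_le` (per direction); §2 ★`sum_sq_norm_sub_norm_le_curl_divB`;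
§3 ★`sum_sq_norm_sub_norm_I_smul_le_plaqK` (`Y = iX`), ★★`sum_sq_norm_sub_norm_pertVar_le_plaqK` (`Y = pertVar U₀ U`, `U = e^{iX}U₀`); §4 ★★`sum_sq_norm_sub_norm_pertVar_le_of_regPr_T3` (the member at level 0 of the Σ∕E2E datum:
`≤ 8·K_W(iX) + 2·DIV_W(iX) + (384a² + 60s² + 12a)·Σ_b‖X b‖²`, `a = e·((L^{K−n})²)⁻¹`).
HONEST FRAMING.  Bookkeeping over landed rows (S–M); nothing of `hN2s`∕H2-1ˢ∕(β)∕hPA2∕hcoS∕E′∕EX∕the crux is proved; rung R3, not Clay; YM gap NOT proved.  `--supports stmt-QuantumFields-19200 --as helper`.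
References: T. Bałaban, CMP 102 (1985) 277–309 [Balaban1985Variational] ((15) p.280, (47)–(48) pp.285–286, (135) p.298); CMP 99 (1985) 389–434 [Balaban1985BackgroundPropagators] ((3.4)–(3.8)
pp.391–392); CMP 98 (1985) 17–51 [Balaban1985Averaging] ((9) p.19, (24) p.21).
-/

set_option autoImplicit false

noncomputable section

open scoped BigOperators Matrix.Norms.L2Operator

namespace Summit.QuantumFields.YangMills.Theorems.Prop7PertVarNormGradLevelZeroT3

open Finset NormedSpace
open Literature.MathematicalPhysics.QuantumFieldTheory.Balaban1983to89
open Literature.MathematicalPhysics.QuantumFieldTheory.Balaban1983to89.T3ContinuumYM3Torus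
open T4Continuum BlockAveraging BlockAveragingEMLLinearisedBackground
open T3PrintedRegularMinimiser (RegPr)
open T3SectALandauChart (emb15)
open B9Eq39Adjoint (curl divB)
open B9TorusCalculus (torusT)
open B10Eq27TorusAxialLog (unitsField toUField)
open Summit.QuantumFields.YangMills.Theorems.Prop7TPrint (expHermField)
open Summit.QuantumFields.YangMills.Theorems.Prop7CovIterLambdaBound (norm_conj_su_le)
open Summit.QuantumFields.YangMills.Theorems.Prop7HolRatioPerStep (coe_star_mul_self)
open Summit.QuantumFields.YangMills.Theorems.Prop7CovIterLambdaHLambdaBridge (sum_normSq_covGrad_le_curl_divB)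
open Summit.QuantumFields.YangMills.Theorems.Prop7PlaquetteCurlComparison (curlHS_le_plaqK)
open Summit.QuantumFields.YangMills.Theorems.Prop7PertVarCurrencyExchange (curlHS_pertVar_le_plaqK divHS_pertVar_le sum_normSq_pertVar_le)
open Summit.QuantumFields.YangMills.Theorems.Prop7TwistedLevelMassOfRegPr (plaq_le_of_regPr)
open Summit.QuantumFields.YangMills.Theorems.Prop7FrameRem2RowZeroT3 (coe_emb15_expHermField_apply)

/-! ## §1 The norm field's gradient against the covariant gradient -/

section Generic

variable {m : Type*} [Fintype m] [DecidableEq m] [Nonempty m]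

/-- `‖Y‖ ≤ ‖u·Y·u⋆‖` for `u ∈ SU(m)` (so with ✓`norm_conj_su_le` the conjugation is an isometry). [folklore] -/
theorem norm_le_norm_conj_su (u : Matrix.specialUnitaryGroup m ℂ) (Y : Matrix m m ℂ) :
    ‖Y‖ ≤ ‖(u : Matrix m m ℂ) * Y * star (u : Matrix m m ℂ)‖ := by
  have hu : ‖(u : Matrix m m ℂ)‖ = 1 := CStarRing.norm_of_mem_unitary (Matrix.mem_specialUnitaryGroup_iff.1 u.2).1
  have hus : ‖star (u : Matrix m m ℂ)‖ = 1 := by rw [norm_star, hu]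
  have hid : star (u : Matrix m m ℂ) * ((u : Matrix m m ℂ) * Y * star (u : Matrix m m ℂ)) * (u : Matrix m m ℂ) = Y := by
    have h1 : star (u : Matrix m m ℂ) * (u : Matrix m m ℂ) = 1 := coe_star_mul_self u
    calc star (u : Matrix m m ℂ) * ((u : Matrix m m ℂ) * Y * star (u : Matrix m m ℂ)) * (u : Matrix m m ℂ)
        = (star (u : Matrix m m ℂ) * (u : Matrix m m ℂ)) * Y * (star (u : Matrix m m ℂ) * (u : Matrix m m ℂ)) := by
          simp only [mul_assoc]
      _ = Y := by rw [h1, one_mul, mul_one]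
  calc ‖Y‖ = ‖star (u : Matrix m m ℂ) * ((u : Matrix m m ℂ) * Y * star (u : Matrix m m ℂ)) * (u : Matrix m m ℂ)‖ := by rw [hid]
    _ ≤ ‖star (u : Matrix m m ℂ)‖ * ‖(u : Matrix m m ℂ) * Y * star (u : Matrix m m ℂ)‖ * ‖(u : Matrix m m ℂ)‖ :=
        (norm_mul_le _ _).trans (mul_le_mul_of_nonneg_right (norm_mul_le _ _) (norm_nonneg _))
    _ = ‖(u : Matrix m m ℂ) * Y * star (u : Matrix m m ℂ)‖ := by rw [hu, hus, one_mul, mul_one]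

/-- **`(‖Y′‖ − ‖Y‖)² ≤ ‖u·Y′·u⋆ − Y‖²`** (`u ∈ SU(m)`): the lattice gradient of the norm field is dominated by the covariant gradient. [cite: Balaban1985Variational, (135) p.298] -/
theorem sq_norm_sub_norm_le_normSq_conj_sub (u : Matrix.specialUnitaryGroup m ℂ) (Y Y' : Matrix m m ℂ) :
    (‖Y'‖ - ‖Y‖) ^ 2 ≤ ‖(u : Matrix m m ℂ) * Y' * star (u : Matrix m m ℂ) - Y‖ ^ 2 := by
  have h1 : ‖Y'‖ ≤ ‖(u : Matrix m m ℂ) * Y' * star (u : Matrix m m ℂ) - Y‖ + ‖Y‖ :=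
    (norm_le_norm_conj_su u Y').trans (norm_le_norm_sub_add _ _)
  have h2 : ‖Y‖ ≤ ‖(u : Matrix m m ℂ) * Y' * star (u : Matrix m m ℂ) - Y‖ + ‖Y'‖ := by
    have := norm_sub_le_norm_sub_add_norm_sub Y ((u : Matrix m m ℂ) * Y' * star (u : Matrix m m ℂ)) 0
    have h3 := norm_conj_su_le u Y'
    rw [sub_zero, sub_zero, norm_sub_rev] at this
    linarith
  exact sq_le_sq' (by linarith) (by linarith)

variable {P : Params} {N : ℕ} {i : ℕ}

/-- summed over bonds and directions: `Σ_bΣ_ν (‖Y(b+e_ν)‖ − ‖Y(b)‖)² ≤ Σ_bΣ_ν ‖U₀(x,ν)·Y(b+e_ν)·U₀(x,ν)⋆ − Y(b)‖²`. [cite: Balaban1985Variational, (135) p.298] -/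
theorem sum_sq_norm_sub_norm_le_covGrad [NeZero N] (U₀ : GaugeField P i (Matrix.specialUnitaryGroup (Fin N) ℂ)) (Y : PBond P i → Matrix (Fin N) (Fin N) ℂ) :
    ∑ b : PBond P i, ∑ ν : Fin P.d, (‖Y ⟨b.src.shift ν, b.dir⟩‖ - ‖Y b‖) ^ 2
      ≤ ∑ b : PBond P i, ∑ ν : Fin P.d,
        ‖((U₀ ⟨b.src, ν⟩ : Matrix.specialUnitaryGroup (Fin N) ℂ) : Matrix (Fin N) (Fin N) ℂ) * Y ⟨b.src.shift ν, b.dir⟩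
            * star ((U₀ ⟨b.src, ν⟩ : Matrix.specialUnitaryGroup (Fin N) ℂ) : Matrix (Fin N) (Fin N) ℂ) - Y b‖ ^ 2 :=
  Finset.sum_le_sum fun _ _ => Finset.sum_le_sum fun _ _ => sq_norm_sub_norm_le_normSq_conj_sub _ _ _

/-- per direction: for every `μ`, `Σ_xΣ_ν (‖Y(x+e_ν,μ)‖ − ‖Y(x,μ)‖)² ≤ Σ_bΣ_ν (‖Y(b+e_ν)‖ − ‖Y(b)‖)²` (the real field `x ↦ ‖Y(x,μ)‖` of the level-0 localisation, one direction at a time;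
lit `sum_pbond`). [cite: Balaban1985Variational, (135) p.298] -/
theorem sum_sq_norm_sub_norm_dir_le (Y : PBond P i → Matrix (Fin N) (Fin N) ℂ) (μ : Fin P.d) :
    ∑ x : Site P i, ∑ ν : Fin P.d, (‖Y ⟨x.shift ν, μ⟩‖ - ‖Y ⟨x, μ⟩‖) ^ 2
      ≤ ∑ b : PBond P i, ∑ ν : Fin P.d, (‖Y ⟨b.src.shift ν, b.dir⟩‖ - ‖Y b‖) ^ 2 := by
  rw [B10StarCount.sum_pbond (fun b : PBond P i => ∑ ν : Fin P.d, (‖Y ⟨b.src.shift ν, b.dir⟩‖ - ‖Y b‖) ^ 2)]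
  exact Finset.sum_le_sum fun x _ => Finset.single_le_sum (f := fun μ' : Fin P.d => ∑ ν : Fin P.d, (‖Y ⟨x.shift ν, μ'⟩‖ - ‖Y ⟨x, μ'⟩‖) ^ 2)
    (fun μ' _ => Finset.sum_nonneg fun ν _ => sq_nonneg _) (Finset.mem_univ μ)

/-! ## §2 ★ Through the Weitzenböck row: `≤ CURL_HS + DIV_HS + 2d·a·N·mass` -/

/-- ★ **THE NORM FIELD's GRADIENT ENERGY ≤ `CURL_HS(Y) + DIV_HS(Y) + 2d·a·N·Σ_b‖Y b‖²`** for any bond field `Y` at an `SU(N)` background with plaquettes within `a` of `1`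
(§1 ∘ ✓`sum_normSq_covGrad_le_curl_divB`). [cite: Balaban1985Variational, (135) p.298; Balaban1985BackgroundPropagators, (3.4)-(3.8) pp.391-392] -/
theorem sum_sq_norm_sub_norm_le_curl_divB [NeZero N] (U₀ : GaugeField P i (Matrix.specialUnitaryGroup (Fin N) ℂ)) {a : ℝ} (ha : 0 ≤ a)
    (hU : ∀ p : Plaq P i, dist1 (GaugeField.plaqHol U₀ p) ≤ a) (Y : PBond P i → Matrix (Fin N) (Fin N) ℂ) :
    ∑ b : PBond P i, ∑ ν : Fin P.d, (‖Y ⟨b.src.shift ν, b.dir⟩‖ - ‖Y b‖) ^ 2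
      ≤ (∑ x : Site P i, ∑ μ : Fin P.d, ∑ ν : Fin P.d,
            (if μ < ν then ∑ j : Fin N, ∑ k : Fin N,
              ‖(curl (torusT P i) (fun κ z => unitsField (toUField U₀) ⟨z, κ⟩) (fun κ z => Y ⟨z, κ⟩) μ ν x) j k‖ ^ 2 else 0)
          + ∑ x : Site P i, ∑ j : Fin N, ∑ k : Fin N,
              ‖(divB (torusT P i) (fun κ z => unitsField (toUField U₀) ⟨z, κ⟩) (fun κ z => Y ⟨z, κ⟩) x) j k‖ ^ 2)
        + 2 * P.d * a * (N * ∑ b : PBond P i, ‖Y b‖ ^ 2) :=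
  (sum_sq_norm_sub_norm_le_covGrad U₀ Y).trans (sum_normSq_covGrad_le_curl_divB U₀ ha hU Y)

/-! ## §3 ★ In X-letters: `Y = iX` and `Y = pertVar U₀ (e^{iX}U₀)` -/

/-- ★ **`Y = iX`**: `Σ_bΣ_ν (‖iX(b+e_ν)‖ − ‖iX(b)‖)² ≤ N·(2·K_{U₀}(iX) + 32d·a²·Σ‖X‖²) + DIV_HS(iX) + 2d·a·N·Σ‖X‖²` (§2 ∘ ✓`curlHS_le_plaqK`, `‖iX‖ = ‖X‖`).
[cite: Balaban1985Variational, (47)-(48) pp.285-286, (135) p.298] -/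
theorem sum_sq_norm_sub_norm_I_smul_le_plaqK [NeZero N] (U₀ : GaugeField P i (Matrix.specialUnitaryGroup (Fin N) ℂ)) {a : ℝ} (ha : 0 ≤ a)
    (hU : ∀ p : Plaq P i, dist1 (GaugeField.plaqHol U₀ p) ≤ a) (X : PBond P i → Matrix (Fin N) (Fin N) ℂ) :
    ∑ b : PBond P i, ∑ ν : Fin P.d, (‖Complex.I • X ⟨b.src.shift ν, b.dir⟩‖ - ‖Complex.I • X b‖) ^ 2
      ≤ N * (2 * (∑ p : Plaq P i, ‖((Complex.I • X ⟨p.src, p.μ⟩)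
          + ((U₀ ⟨p.src, p.μ⟩ : Matrix (Fin N) (Fin N) ℂ) * (Complex.I • X ⟨p.src.shift p.μ, p.ν⟩) * star (U₀ ⟨p.src, p.μ⟩ : Matrix (Fin N) (Fin N) ℂ))
          - (((U₀ ⟨p.src, p.μ⟩ * U₀ ⟨p.src.shift p.μ, p.ν⟩ * (U₀ ⟨p.src.shift p.ν, p.μ⟩)⁻¹ : Matrix.specialUnitaryGroup (Fin N) ℂ) : Matrix (Fin N) (Fin N) ℂ)
              * (Complex.I • X ⟨p.src.shift p.ν, p.μ⟩)
              * star ((U₀ ⟨p.src, p.μ⟩ * U₀ ⟨p.src.shift p.μ, p.ν⟩ * (U₀ ⟨p.src.shift p.ν, p.μ⟩)⁻¹ : Matrix.specialUnitaryGroup (Fin N) ℂ) : Matrix (Fin N) (Fin N) ℂ))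
          - (((GaugeField.plaqHol U₀ p : Matrix.specialUnitaryGroup (Fin N) ℂ) : Matrix (Fin N) (Fin N) ℂ) * (Complex.I • X ⟨p.src, p.ν⟩)
              * star ((GaugeField.plaqHol U₀ p : Matrix.specialUnitaryGroup (Fin N) ℂ) : Matrix (Fin N) (Fin N) ℂ)))‖ ^ 2)
        + 32 * P.d * a ^ 2 * ∑ b : PBond P i, ‖X b‖ ^ 2)
        + ∑ x : Site P i, ∑ j : Fin N, ∑ k : Fin N,
            ‖(divB (torusT P i) (fun κ z => unitsField (toUField U₀) ⟨z, κ⟩) (fun κ z => Complex.I • X ⟨z, κ⟩) x) j k‖ ^ 2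
        + 2 * P.d * a * (N * ∑ b : PBond P i, ‖X b‖ ^ 2) := by
  have hI : ∀ b, ‖Complex.I • X b‖ = ‖X b‖ := fun b => by rw [norm_smul, Complex.norm_I, one_mul]
  have h1 := sum_sq_norm_sub_norm_le_curl_divB U₀ ha hU (fun b => Complex.I • X b)
  have h2 := curlHS_le_plaqK U₀ hU X
  have hmass : ∑ b : PBond P i, ‖Complex.I • X b‖ ^ 2 = ∑ b : PBond P i, ‖X b‖ ^ 2 := Finset.sum_congr rfl fun b _ => by rw [hI]
  simp only [hmass] at h1
  linarith

/-- ★★ **`Y = pertVar U₀ U`, `U = e^{iX}U₀`** (`X` Hermitian, `‖X b‖ ≤ s`, plaquettes of `U₀` within `a`):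
`Σ_bΣ_ν (‖Y(b+e_ν)‖ − ‖Y(b)‖)² ≤ 4N·K_{U₀}(iX) + 2·DIV_HS(iX) + (N·d·(64a² + 8s²) + 2N·d·s² + 2d·a·N)·Σ‖X‖²` (§2 ∘ ✓`curlHS_pertVar_le_plaqK` ∘ ✓`divHS_pertVar_le` ∘ ✓`sum_normSq_pertVar_le`).
[cite: Balaban1985Variational, (15) p.280, (47)-(48) pp.285-286, (135) p.298] -/
theorem sum_sq_norm_sub_norm_pertVar_le_plaqK [NeZero N] (U₀ U : GaugeField P i (Matrix.specialUnitaryGroup (Fin N) ℂ)) (X : PBond P i → Matrix (Fin N) (Fin N) ℂ)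
    (hX : ∀ b, (X b).IsHermitian)
    (hUX : ∀ b, ((U b : Matrix.specialUnitaryGroup (Fin N) ℂ) : Matrix (Fin N) (Fin N) ℂ)
      = exp (Complex.I • X b) * ((U₀ b : Matrix.specialUnitaryGroup (Fin N) ℂ) : Matrix (Fin N) (Fin N) ℂ))
    {s : ℝ} (hs : ∀ b, ‖X b‖ ≤ s) {a : ℝ} (ha : 0 ≤ a) (hU : ∀ p : Plaq P i, dist1 (GaugeField.plaqHol U₀ p) ≤ a) :
    ∑ b : PBond P i, ∑ ν : Fin P.d, (‖pertVar U₀ U ⟨b.src.shift ν, b.dir⟩‖ - ‖pertVar U₀ U b‖) ^ 2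
      ≤ 4 * N * (∑ p : Plaq P i, ‖((Complex.I • X ⟨p.src, p.μ⟩)
          + ((U₀ ⟨p.src, p.μ⟩ : Matrix (Fin N) (Fin N) ℂ) * (Complex.I • X ⟨p.src.shift p.μ, p.ν⟩) * star (U₀ ⟨p.src, p.μ⟩ : Matrix (Fin N) (Fin N) ℂ))
          - (((U₀ ⟨p.src, p.μ⟩ * U₀ ⟨p.src.shift p.μ, p.ν⟩ * (U₀ ⟨p.src.shift p.ν, p.μ⟩)⁻¹ : Matrix.specialUnitaryGroup (Fin N) ℂ) : Matrix (Fin N) (Fin N) ℂ)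
              * (Complex.I • X ⟨p.src.shift p.ν, p.μ⟩)
              * star ((U₀ ⟨p.src, p.μ⟩ * U₀ ⟨p.src.shift p.μ, p.ν⟩ * (U₀ ⟨p.src.shift p.ν, p.μ⟩)⁻¹ : Matrix.specialUnitaryGroup (Fin N) ℂ) : Matrix (Fin N) (Fin N) ℂ))
          - (((GaugeField.plaqHol U₀ p : Matrix.specialUnitaryGroup (Fin N) ℂ) : Matrix (Fin N) (Fin N) ℂ) * (Complex.I • X ⟨p.src, p.ν⟩)
              * star ((GaugeField.plaqHol U₀ p : Matrix.specialUnitaryGroup (Fin N) ℂ) : Matrix (Fin N) (Fin N) ℂ)))‖ ^ 2)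
        + 2 * ∑ x : Site P i, ∑ j : Fin N, ∑ k : Fin N,
            ‖(divB (torusT P i) (fun κ z => unitsField (toUField U₀) ⟨z, κ⟩) (fun κ z => Complex.I • X ⟨z, κ⟩) x) j k‖ ^ 2
        + (N * P.d * (64 * a ^ 2 + 8 * s ^ 2) + 2 * N * P.d * s ^ 2 + 2 * P.d * a * N) * ∑ b : PBond P i, ‖X b‖ ^ 2 := by
  have h1 := sum_sq_norm_sub_norm_le_curl_divB U₀ ha hU (pertVar U₀ U)
  have h2 := curlHS_pertVar_le_plaqK U₀ U X hX hUX hs hU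
  have h3 := divHS_pertVar_le U₀ U X hX hUX hs
  have h4 := sum_normSq_pertVar_le U₀ U X hX hUX
  have hM : 0 ≤ ∑ b : PBond P i, ‖X b‖ ^ 2 := Finset.sum_nonneg fun _ _ => sq_nonneg _
  have hdaN : (0 : ℝ) ≤ 2 * P.d * a * N := by positivity
  have h5 := mul_le_mul_of_nonneg_left h4 hdaN
  nlinarith [h1, h2, h3, h5, hM]

end Generic

/-! ## §4 ★★ The member: level 0 of the Σ∕E2E datum on T³ -/

section T3

variable (F : T3Family) (n K : ℕ)

/-- ★★ **N4b AT THE MEMBER**: for `W ∈ 𝔘_k(e)` (`RegPr F n K e W`, `0 ≤ e`), `X` Hermitian traceless with `‖X b‖ ≤ s`, `Y_0 := pertVar W (e^{iX}W)`: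
`Σ_bΣ_ν (‖Y_0(b+e_ν)‖ − ‖Y_0(b)‖)² ≤ 8·K_W(iX) + 2·DIV_W(iX) + (384a² + 60s² + 12a)·Σ_b‖X b‖²` with `a = e·((L^{K−n})²)⁻¹` — the X-currency of px16's `hN2s` B-slot
(`K_W`, `DIV_W` VERBATIM; `a`, `s²` are `ℓ⁻²`-sized at the datum `s = σℓ⁻¹`). [cite: Balaban1985Variational, (2) p.278, (15) p.280, (47)-(48) pp.285-286, (135) p.298] -/
theorem sum_sq_norm_sub_norm_pertVar_le_of_regPr_T3 {e s : ℝ} (he : 0 ≤ e)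
    {W : GaugeField (F.P K) 0 (Matrix.specialUnitaryGroup (Fin 2) ℂ)} (hreg : RegPr F n K e W)
    (X : PBond (F.P K) 0 → Matrix (Fin 2) (Fin 2) ℂ) (hX : ∀ b : PBond (F.P K) 0, (X b).IsHermitian ∧ Matrix.trace (X b) = 0)
    (hs : ∀ b : PBond (F.P K) 0, ‖X b‖ ≤ s) :
    ∑ b : PBond (F.P K) 0, ∑ ν : Fin (F.P K).d,
        (‖pertVar W (emb15 W (expHermField X)) ⟨b.src.shift ν, b.dir⟩‖ - ‖pertVar W (emb15 W (expHermField X)) b‖) ^ 2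
      ≤ 8 * (∑ p : Plaq (F.P K) 0, ‖((Complex.I • X ⟨p.src, p.μ⟩)
          + ((W ⟨p.src, p.μ⟩ : Matrix (Fin 2) (Fin 2) ℂ) * (Complex.I • X ⟨p.src.shift p.μ, p.ν⟩) * star (W ⟨p.src, p.μ⟩ : Matrix (Fin 2) (Fin 2) ℂ))
          - (((W ⟨p.src, p.μ⟩ * W ⟨p.src.shift p.μ, p.ν⟩ * (W ⟨p.src.shift p.ν, p.μ⟩)⁻¹ : Matrix.specialUnitaryGroup (Fin 2) ℂ) : Matrix (Fin 2) (Fin 2) ℂ)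
              * (Complex.I • X ⟨p.src.shift p.ν, p.μ⟩)
              * star ((W ⟨p.src, p.μ⟩ * W ⟨p.src.shift p.μ, p.ν⟩ * (W ⟨p.src.shift p.ν, p.μ⟩)⁻¹ : Matrix.specialUnitaryGroup (Fin 2) ℂ) : Matrix (Fin 2) (Fin 2) ℂ))
          - (((GaugeField.plaqHol W p : Matrix.specialUnitaryGroup (Fin 2) ℂ) : Matrix (Fin 2) (Fin 2) ℂ) * (Complex.I • X ⟨p.src, p.ν⟩)
              * star ((GaugeField.plaqHol W p : Matrix.specialUnitaryGroup (Fin 2) ℂ) : Matrix (Fin 2) (Fin 2) ℂ)))‖ ^ 2)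
        + 2 * ∑ x : Site (F.P K) 0, ∑ j : Fin 2, ∑ k : Fin 2,
            ‖(divB (torusT (F.P K) 0) (fun κ z => unitsField (toUField W) ⟨z, κ⟩) (fun κ z => Complex.I • X ⟨z, κ⟩) x) j k‖ ^ 2
        + (384 * (e * (((F.L : ℝ) ^ (K - n)) ^ 2)⁻¹) ^ 2 + 60 * s ^ 2 + 12 * (e * (((F.L : ℝ) ^ (K - n)) ^ 2)⁻¹)) * ∑ b : PBond (F.P K) 0, ‖X b‖ ^ 2 := by
  have ha : 0 ≤ e * (((F.L : ℝ) ^ (K - n)) ^ 2)⁻¹ := by positivity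
  have h := sum_sq_norm_sub_norm_pertVar_le_plaqK W (emb15 W (expHermField X)) X (fun b => (hX b).1)
    (coe_emb15_expHermField_apply F W X hX) hs ha (plaq_le_of_regPr F n K hreg)
  have hd : ((F.P K).d : ℝ) = 3 := by rw [T3Family.P_d]; norm_num
  simp only [hd, Nat.cast_ofNat] at h
  have hM : 0 ≤ ∑ b : PBond (F.P K) 0, ‖X b‖ ^ 2 := Finset.sum_nonneg fun _ _ => sq_nonneg _
  nlinarith [h, hM]

end T3

end Summit.QuantumFields.YangMills.Theorems.Prop7PertVarNormGradLevelZeroT3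

end
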